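import Summits.Langlands.Langlands.Theses.EvenIcosahedralCMCorner

/-!
# Route EvenIcosahedralCMCorner — Assembly

The assembly item (stmt-Langlands-14081) of the OPEN route `EvenIcosahedralCMCorner`:
`CMOrdinaryDoor → ProAutomorphyAtKleinPrime → ArtinPointClassicalityCM → UntwistAutomorphy →
SolubleDescentMatching → NonDistinguishedComplement → EvenArtinJunction → Langlands`.

This is the type of the route file's sorry-free deciding theorem
`Summit.Langlands.Langlands.Theses.EvenIcosahedralCMCorner.closes`, whose last hypothesis is stated as
`SectorJunction := EvenIcosahedralStrongArtin → Langlands`; the assembly's `EvenArtinJunction` is the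
same implication with `EvenIcosahedralStrongArtin` unfolded (definitionally equal). Nothing here proves
`Langlands`: the assembly records only that the items of the route, taken together, imply the summit
by name (registry hygiene; count-neutral).
-/

set_option linter.dupNamespace false -- `Summit.Langlands.Langlands` is the mandated namespace

namespace Summit.Langlands.Langlands.Theorems

/-- **Assembly of route EvenIcosahedralCMCorner** (stmt-Langlands-14081):
`CMOrdinaryDoor → ProAutomorphyAtKleinPrime → ArtinPointClassicalityCM → UntwistAutomorphy →
SolubleDescentMatching → NonDistinguishedComplement → EvenArtinJunction → Langlands`.
Proof: the route's deciding theorem `Theses.EvenIcosahedralCMCorner.closes`, its `SectorJunction`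
hypothesis being supplied by `EvenArtinJunction` (definitionally the same implication). -/
theorem evenIcosahedralCMCorner_assembly_proof :
    Summit.Langlands.Langlands.Theses.EvenIcosahedralCMCorner.Assembly := by
  unfold Summit.Langlands.Langlands.Theses.EvenIcosahedralCMCorner.Assembly
  intro hD hE hF hG hH hC hJ
  exact Summit.Langlands.Langlands.Theses.EvenIcosahedralCMCorner.closes hD hE hF hG hH hC
    (fun h => hJ h)

end Summit.Langlands.Langlands.Theorems
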